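import Literature.NumberTheory.IwasawaTheory.Greenberg2016.DualShaTorsionOfPoitouTate
import Literature.NumberTheory.GaloisCohomology.PoitouTateRestrictedRamificationNaturalAt
import HarnessLib

/-!
# Greenberg 2010 Prop. 3.2.1 (γ) — `Ш¹(K, Σ, T*)` is `Λ`-torsion under `LEO(𝐃)` — from the natural
# restricted Poitou–Tate Ш-duality AT THE ONE FINITE `Σ` IN PLAY (re-typing of
# `dualSha_torsion_of_poitouTateNatural` / `dualSha_torsion_of_poitouTate`; theorems only)

Topic `NumberTheory/IwasawaTheory/Greenberg2016`; namespace
`Literature.NumberTheory.IwasawaTheory.Greenberg2016`; THEOREMS ONLY (no definition, no named fact, no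
`sorry`, no instance).  Road «SUR-Λ» of cell `bsd-eis` (crux `GoodLatticeBDPValue`,
stmt-BirchSwinnertonDyer-19032), `--supports stmt-BirchSwinnertonDyer-19032`.

The tree's `dualSha_torsion_of_poitouTateNatural` (`ShaDualityTowerOfPoitouTate.lean`) and its
bookkeeping-free form `dualSha_torsion_of_poitouTate` (`DualShaTorsionOfPoitouTate.lean`) take the
textbook named fact `hX : poitouTate_shaRestricted_tateDual_natural K` — Milne ADT I Thm. 4.10 (a),
natural form, for EVERY set of places of `K` at once — and use it at ONE set of places only
(`obtain ⟨B, hP, hN⟩ := hX S`, `S = Σ` finite, `Σ ⊇ {v ∣ p}`).  This file re-types both on the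
POINTWISE statement `poitouTate_shaRestricted_tateDual_natural_at K S`
(`PoitouTateRestrictedRamificationNaturalAt.lean`: the same body at `S`, token for token), so that the
consumer carries exactly the instance it reads, and so that a kernel proof of the duality for FINITE
`S` (the target of the background lane «PT-Ш-S-TC», whose `S`-idèle class module
`IdeleClassBar.classBarSD` is typed for finite `S`) discharges it by name:

* **`dualSha_torsion_of_poitouTateNaturalAt`** — verbatim `dualSha_torsion_of_poitouTateNatural` with
  `hX : poitouTate_shaRestricted_tateDual_natural_at K S` (same proof, first line `:= hX`);
* **`dualSha_torsion_of_poitouTateAt`** — verbatim `dualSha_torsion_of_poitouTate` (bookkeeping `hurD`,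
  `hcard` discharged from `p ∈ S`) on the pointwise hypothesis;
* nothing else: the tree's two theorems are the new ones at `hX S`
  (`poitouTate_shaRestricted_tateDual_natural_iff_forall_at`), so no old-from-new restatement is added
  (it would duplicate p706362's statements).

HONESTY: the Ш-duality at `S` is the INPUT `hX` (a named statement); no case of Greenberg's
propositions, of Poitou–Tate duality, or of BSD is proved here.  AI formalisation, weaker than expert
review; the statements are established only by the kernel check.

## References
* R. Greenberg, *Surjectivity of the global-to-local map defining a Selmer group*, Kyoto J. Math. 50
  (2010), proof of Prop. 3.2.1 (p. 15 L19–32), §2.1 (6) p. 7, §3.1 p. 14. [Greenberg2010]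
* J. S. Milne, *Arithmetic Duality Theorems*, 2nd ed. (2006), I Thm. 4.10 (a) (p. 57) and §4 p. 65.
  [MilneADT2006]
-/

noncomputable section

open scoped Classical
open Function CategoryTheory NumberField IsDedekindDomain Field IsLocalRing
open _root_.TopRep _root_.ContRepresentation _root_.ContinuousCohomology
open Literature.NumberTheory.GaloisRepresentations
open Literature.NumberTheory.GaloisRepresentations.DiscreteGaloisModule
open Literature.NumberTheory.GaloisRepresentations.DiscreteGaloisModule.TorsionLayers
open Literature.NumberTheory.GaloisCohomology
open Literature.NumberTheory.IwasawaTheory.Greenberg2006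

namespace Literature.NumberTheory.IwasawaTheory.Greenberg2016

variable {K : Type} [Field K] [NumberField K] {S : Set (HeightOneSpectrum (𝓞 K))}
  {Λ : Type} [CommRing Λ] [TopologicalSpace Λ]
  {D : Type} [AddCommGroup D] [Module Λ D] [TopologicalSpace D] [DiscreteTopology D]
  [ContinuousSMul Λ D]
  (ρ : ContinuousRep (GaloisGroupUnramifiedOutside K S) Λ D)
  {p : ℕ} [Fact p.Prime] {m : ℕ} [IsLocalRing Λ]
  (e : Λ ≃+* MvPowerSeries (Fin m) ℤ_[p]) (hD : IsCofinitelyGenerated Λ D)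

/-- **`Ш¹(K, Σ, T*)` is `Λ`-torsion under `LEO(𝐃)`, from the natural restricted Poitou–Tate Ш-duality
AT `Σ`** (Milne ADT I Thm. 4.10 (a) with the functoriality of its pairing, read at the one finite
`S = Σ` of the setting: `hX : poitouTate_shaRestricted_tateDual_natural_at K S`): for every
`y ∈ dualSha ρ e hD inv` there is `r ≠ 0` with `H¹(θ̂_r) y = 0`.  Verbatim the tree's
`dualSha_torsion_of_poitouTateNatural` with the pointwise hypothesis (its proof used `hX` at `S` only).
[cite: Greenberg2010, proof of Prop. 3.2.1 (p. 15 L19–21), §2.1 (6) p. 7]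
[cite: MilneADT2006, Ch. I, Thm. 4.10 (a) and §4 p. 65] -/
theorem dualSha_torsion_of_poitouTateNaturalAt [Finite (SigmaPlace S)] [CompactSpace (absoluteGaloisGroup K)]
    (hX : poitouTate_shaRestricted_tateDual_natural_at K S)
    (hurD : ∀ k, GaloisRep.IsUnramifiedOutside S ((torsionLayers ρ e hD).layerDualRep k))
    (hcard : ∀ (k : ℕ) (v : HeightOneSpectrum (𝓞 K)),
      ((Nat.card ↥(Submodule.torsionBySet Λ D ((maximalIdeal Λ ^ k : Ideal Λ) : Set Λ)) : ℕ) : 𝓞 K) ∈ v.asIdeal → v ∈ S)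
    (inv : ∀ k : ℕ, LocalInvariants K (p ^ k))
    (hinv : ∀ v : Place K, InvLevelLaw inv v) (hUO : ∀ k, (inv k).UnramifiedOrthogonal)
    (hSp : ∀ w : HeightOneSpectrum (𝓞 K), ((p : ℕ) : 𝓞 K) ∈ w.asIdeal → w ∈ S)
    (hLEO : LEO S ρ)
    (y : continuousCohomology 1 (torsionLayers ρ e hD).dualSystem.limitRep.toTopRep) (hy : y ∈ dualSha ρ e hD inv) :
    ∃ r : Λ, r ≠ 0 ∧ cohomologyMap (scalarDualEndHom ρ e hD r) 1 y = 0 := by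
  haveI : ∀ k : ℕ, Finite ↥(Submodule.torsionBySet Λ D ((maximalIdeal Λ ^ k : Ideal Λ) : Set Λ)) := fun k => (torsionLayers ρ e hD).finite k
  obtain ⟨B, hP, hN⟩ := hX
  -- the hypotheses of Milne I 4.10 (a) at each level
  have htor : ∀ (k : ℕ) (x : ↥(Submodule.torsionBySet Λ D ((maximalIdeal Λ ^ k : Ideal Λ) : Set Λ))), p ^ k • x = 0 := fun k x => by
    apply Subtype.ext
    rw [Submodule.coe_smul_of_tower, Submodule.coe_zero, ← Nat.cast_smul_eq_nsmul Λ, Nat.cast_pow]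
    exact (Submodule.mem_torsionBySet_iff _ _).1 x.2
      ⟨(p : Λ) ^ k, Ideal.pow_mem_pow (natCast_mem_maximalIdeal_of_ringEquiv_mvPowerSeries e) k⟩
  have hurM : ∀ k, GaloisRep.IsUnramifiedOutside S (toGaloisModule S (torsionLevelRep ρ k)) := fun k =>
    isUnramifiedOutside_toGaloisModule S _
  have hN' := fun k l => levelPairing_natural_of_fact ρ e hD B k l
    (hN (p ^ k) ↥(Submodule.torsionBySet Λ D ((maximalIdeal Λ ^ k : Ideal Λ) : Set Λ)) (toGaloisModule S (torsionLevelRep ρ k)) (p ^ l) ↥(Submodule.torsionBySet Λ D ((maximalIdeal Λ ^ l : Ideal Λ) : Set Λ)) (toGaloisModule S (torsionLevelRep ρ l))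
      (htor k) (hurM k) (hcard k) (htor l) (hurM l) (hcard l))
  have hP' := fun k => levelPairing_flip_injective_of_fact ρ e hD B k
    (hP (p ^ k) ↥(Submodule.torsionBySet Λ D ((maximalIdeal Λ ^ k : Ideal Λ) : Set Λ)) (toGaloisModule S (torsionLevelRep ρ k)) (htor k) (hurM k) (hcard k)).2.2.2
  exact dualSha_torsion_of_shaDualityTower ρ e hD inv hinv hUO hSp (towerPairing ρ e hD B hurD)
    ⟨fun h z => redHom_mem_shaOneDualLevel S (torsionLayers ρ e hD) h z.2,
      fun h x z => towerPairing_natural ρ e hD B hurD h (hN' _ _) x z⟩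
    (fun k z hz => towerPairing_nondegenerate ρ e hD B hurD k (hP' k) z hz)
    (fun r k x z => towerPairing_smul ρ e hD B hurD k r (hN' k k) x z) hLEO y hy

/-- **(γ) of Greenberg 2010 Prop. 3.2.1 from the natural restricted Poitou–Tate Ш-duality AT `Σ`,
bookkeeping discharged**: `poitouTate_shaRestricted_tateDual_natural_at K S` and `LEO(𝐃)` imply that
every `y ∈ Ш¹(K, Σ, T*) = dualSha ρ e hD inv` is killed by `H¹(θ̂_r)` for some `r ≠ 0` — the hypothesis
`hSha` of `Specification.sur_of_dualSelmer_inputs` / `sur_of_crk_caseC_tc_of_dualSha_torsion`.  Verbatim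
the tree's `dualSha_torsion_of_poitouTate` with the pointwise hypothesis.
[cite: Greenberg2010, proof of Prop. 3.2.1 (p. 15 L19–21), §2.1 (6) p. 7]
[cite: MilneADT2006, Ch. I, Thm. 4.10 (a) and §4 p. 65] -/
theorem dualSha_torsion_of_poitouTateAt [Finite (SigmaPlace S)] [CompactSpace (absoluteGaloisGroup K)]
    (hX : poitouTate_shaRestricted_tateDual_natural_at K S)
    (inv : ∀ k : ℕ, LocalInvariants K (p ^ k))
    (hinv : ∀ v : Place K, InvLevelLaw inv v) (hUO : ∀ k, (inv k).UnramifiedOrthogonal)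
    (hSp : ∀ w : HeightOneSpectrum (𝓞 K), ((p : ℕ) : 𝓞 K) ∈ w.asIdeal → w ∈ S)
    (hLEO : LEO S ρ)
    (y : continuousCohomology 1 (torsionLayers ρ e hD).dualSystem.limitRep.toTopRep)
    (hy : y ∈ dualSha ρ e hD inv) :
    ∃ r : Λ, r ≠ 0 ∧ cohomologyMap (scalarDualEndHom ρ e hD r) 1 y = 0 :=
  dualSha_torsion_of_poitouTateNaturalAt ρ e hD hX
    (isUnramifiedOutside_layerDualRep_torsionLayers ρ e hD hSp)
    (fun k v h => by
      haveI : Finite ↥(Submodule.torsionBySet Λ D ((maximalIdeal Λ ^ k : Ideal Λ) : Set Λ)) :=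
        (torsionLayers ρ e hD).finite k
      exact mem_of_natCard_torsionBySet_mem (natCast_mem_maximalIdeal_of_ringEquiv_mvPowerSeries e)
        hSp k v h)
    inv hinv hUO hSp hLEO y hy

end Literature.NumberTheory.IwasawaTheory.Greenberg2016

end
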